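import Summits.SmoothPoincare4.SmoothPoincare4.Theorems.EntropyRungNoncompactShrinkerGapHeatCutoffToolkit
import HarnessLib

/-!
# The energy estimate `∫₀ᵀ∫ |∇ρ|² e^{-V} ≤ ½ ∫ (ρ₀ − c₀)² e^{-V}` for the weighted heat flow on a
# complete manifold (crux `EntropyRung.NoncompactShrinkerGap`, stmt-SmoothPoincare4-10868, line
# `collapsed-ends-usc`, v13; registered helper `helper_energyEstimate`)

Setting: `(M, g)` Riemannian, modelled on `ℝⁿ` (Hausdorff, second countable, NOT compact), `V`
smooth, `L = Δ_g − g⁻¹(dV, d·)`, weight `e^{-V}`; cut-offs `η_k ∈ C_c^∞`, `0 ≤ η_k ≤ 1`, `η_k ↑`,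
eventually `= 1` near every point, `|Lη_k| ≤ C`; `ρ` smooth on `M × O`, `O ⊇ [0, T]` open, with
`∂ₛρ = Lρ` on `[0, T]`.

* `two_mul_integral_gradSq_cutoff_eq` — for ONE compactly supported smooth `η` the integrated
  energy identity `2 ∫∫_{M×(0,T)} |∇ρ|² η e^{-V} = E(0) − E(T) + ∫∫_{M×(0,T)} (ρ − c₀)² (Lη) e^{-V}`,
  `E(s) = ∫ (ρ(s) − c₀)² η e^{-V}`: Leibniz rule with the compactly supported weight `η e^{-V}`,
  the energy identity with a cut-off `2∫ (ρ − c₀) η (Lρ) e^{-V} = −2∫ η|∇ρ|² e^{-V} + ∫ (ρ − c₀)² (Lη) e^{-V}`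
  (`CutoffToolkit.integral_sub_mul_cutoff_mul_weightedLaplacian`), the fundamental theorem of
  calculus on `[0, T]` and Fubini on the strip.
* `helper_energyEstimate` — if `(ρ − c₀)² e^{-V}` is integrable on the strip and at `s = 0`, then
  `|∇ρ|² e^{-V}` is integrable on the strip and `∫∫ |∇ρ|² e^{-V} ≤ ½ ∫ (ρ(0) − c₀)² e^{-V}`:
  with `η = η_k`, `E_k(T) ≥ 0`, `E_k(0) ≤ ∫ (ρ₀ − c₀)² e^{-V}`, the error
  `∫∫ (ρ − c₀)² (Lη_k) e^{-V} → 0` by dominated convergence (`|Lη_k| ≤ C`, `Lη_k → 0` pointwise),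
  and `k → ∞` by Fatou / dominated convergence (`η_k ↑ 1`).

Source of the argument: the energy method with cut-offs of J. A. Carrillo, L. Ni, Comm. Anal. Geom.
17 (2009), §4 [CarrilloNi2009]; A. Grigor'yan, *Heat kernel and analysis on manifolds* (2009),
Ch. 7–8 (weighted manifolds, integrated energy identities).
-/

noncomputable section

set_option linter.dupNamespace false

open scoped Manifold ContDiff ENNReal NNReal Topology
open MeasureTheory Set Filter
open Literature.Geometry.Lorentzian Literature.Geometry.Riemannian

namespace Summit.SmoothPoincare4.SmoothPoincare4.Theorems.NoncompactShrinkerGapHeat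

open CutoffToolkit

section Energy

variable {n : ℕ} {M : Type*} [TopologicalSpace M] [T2Space M] [SecondCountableTopology M]
  [ChartedSpace (EuclideanSpace ℝ (Fin n)) M] [IsManifold (𝓡 n) ∞ M] [T3Space M]
  [MeasurableSpace M] [BorelSpace M]
  {g : PseudoRiemannianMetric (𝓡 n) ∞ (EuclideanSpace ℝ (Fin n)) (TangentSpace (𝓡 n) : M → Type _)}
  [g.HasLeviCivita]

/-- **The integrated energy identity with one cut-off.** For `V` smooth, `η ∈ C_c^∞`, `ρ` smooth on
`M × O` (`O ⊇ [0, T]` open) with `∂ₛρ = Lρ` on `[0, T]`, and a constant `c₀`,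
`2 ∫∫_{M×(0,T)} |∇ρ|² η e^{-V} = E(0) − E(T) + ∫∫_{M×(0,T)} (ρ − c₀)² (Lη) e^{-V}`,
`E(s) = ∫ (ρ(s) − c₀)² η e^{-V} dV`: `E' = 2∫ (ρ − c₀)(Lρ) η e^{-V} = −2∫ η|∇ρ|² e^{-V} + ∫ (ρ − c₀)²(Lη)e^{-V}`
(Leibniz rule, `integral_sub_mul_cutoff_mul_weightedLaplacian`), integrated over `[0, T]` (FTC,
Fubini). [cite: CarrilloNi2009, §4 (integration by parts on the complete soliton)] -/
theorem two_mul_integral_gradSq_cutoff_eq (hg : g.IsRiemannian) {V : M → ℝ}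
    (hV : ContMDiff (𝓡 n) 𝓘(ℝ, ℝ) ∞ V) {η : M → ℝ} (hη : ContMDiff (𝓡 n) 𝓘(ℝ, ℝ) ∞ η)
    (hηc : HasCompactSupport η) {T : ℝ} {O : Set ℝ} {ρ : ℝ → M → ℝ} (hT : 0 < T) (hO : IsOpen O)
    (hTO : Icc 0 T ⊆ O)
    (hρ : ContMDiffOn ((𝓡 n).prod 𝓘(ℝ, ℝ)) 𝓘(ℝ, ℝ) ∞ (fun p : M × ℝ ↦ ρ p.2 p.1) (univ ×ˢ O))
    (heq : ∀ s ∈ Icc 0 T, ∀ x, deriv (fun r ↦ ρ r x) s = g.dalembertian (ρ s) x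
      - g.innerDual x (mvfderiv (𝓡 n) V x).toLinearMap (mvfderiv (𝓡 n) (ρ s) x).toLinearMap)
    (c₀ : ℝ) :
    2 * ∫ p, g.gradSq (ρ p.2) p.1 * (η p.1 * Real.exp (-V p.1))
        ∂(g.riemVolume.prod (volume : Measure ℝ)).restrict (univ ×ˢ Ioo 0 T) =
      ∫ x, (ρ 0 x - c₀) ^ 2 * (η x * Real.exp (-V x)) ∂g.riemVolume
        - ∫ x, (ρ T x - c₀) ^ 2 * (η x * Real.exp (-V x)) ∂g.riemVolume
        + ∫ p, (ρ p.2 p.1 - c₀) ^ 2 * ((g.dalembertian η p.1 - g.innerDual p.1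
            (mvfderiv (𝓡 n) V p.1).toLinearMap (mvfderiv (𝓡 n) η p.1).toLinearMap) *
              Real.exp (-V p.1)) ∂(g.riemVolume.prod (volume : Measure ℝ)).restrict (univ ×ˢ Ioo 0 T) := by
  haveI := CarrilloNi2009_shrinkerLSI.isFiniteMeasureOnCompacts_riemVolume hg
  haveI := sigmaFinite_riemVolume hg
  have h01 : (0 : ℝ) ≤ T := hT.le
  have h1 : (1 : ℕ∞ω) ≤ (∞ : ℕ∞ω) := WithTop.coe_le_coe.mpr le_top
  have h2 : (2 : ℕ∞ω) ≤ (∞ : ℕ∞ω) := WithTop.coe_le_coe.mpr le_top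
  set μ : Measure M := g.riemVolume with hμ
  -- the two compactly supported weights `η e^{-V}` and `(Lη) e^{-V}`
  set Lη : M → ℝ := fun x ↦ g.dalembertian η x
    - g.innerDual x (mvfderiv (𝓡 n) V x).toLinearMap (mvfderiv (𝓡 n) η x).toLinearMap with hLη
  have hec : Continuous fun x ↦ Real.exp (-V x) := Real.continuous_exp.comp hV.continuous.neg
  have hwE : Continuous fun x ↦ η x * Real.exp (-V x) := hη.continuous.mul hec
  have hwEc : HasCompactSupport fun x ↦ η x * Real.exp (-V x) := hηc.mul_right
  have hLηc : Continuous Lη :=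
    (continuous_dalembertian g (hη.of_le h2)).sub
      (continuous_innerDual_mvfderiv g (hV.of_le h1) (hη.of_le h1))
  have hLηs : HasCompactSupport Lη := by
    refine HasCompactSupport.intro hηc fun x hx ↦ ?_
    simp only [hLη]
    rw [g.dalembertian_eq_zero_of_notMem_tsupport hx,
      innerDual_mvfderiv_eq_zero_of_notMem_tsupport_right hx, sub_zero]
  have hwR : Continuous fun x ↦ Lη x * Real.exp (-V x) := hLηc.mul hec
  have hwRc : HasCompactSupport fun x ↦ Lη x * Real.exp (-V x) := hLηs.mul_right
  -- slices and time derivatives of `ρ`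
  have hslice : ∀ s ∈ O, ContMDiff (𝓡 n) 𝓘(ℝ, ℝ) ∞ (ρ s) := fun s hs ↦
    contMDiff_slice_of_contMDiffOn hρ hs
  have hρc : ContinuousOn (fun p : M × ℝ ↦ ρ p.2 p.1) (univ ×ˢ O) := hρ.continuousOn
  have hρ'c : ContinuousOn (fun p : M × ℝ ↦ deriv (fun r ↦ ρ r p.1) p.2) (univ ×ˢ O) :=
    continuousOn_deriv_time hO hρ
  have hF : ContinuousOn (fun p : M × ℝ ↦ (ρ p.2 p.1 - c₀) ^ 2) (univ ×ˢ O) :=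
    (hρc.sub continuousOn_const).pow 2
  have hF' : ContinuousOn (fun p : M × ℝ ↦ 2 * (ρ p.2 p.1 - c₀) * deriv (fun r ↦ ρ r p.1) p.2)
      (univ ×ˢ O) := (continuousOn_const.mul (hρc.sub continuousOn_const)).mul hρ'c
  have hd : ∀ s ∈ O, ∀ x, HasDerivAt (fun r ↦ (ρ r x - c₀) ^ 2)
      (2 * (ρ s x - c₀) * deriv (fun r ↦ ρ r x) s) s := by
    intro s hs x
    have h := ((hasDerivAt_time hO hρ x hs).sub_const c₀).pow 2
    refine h.congr_deriv ?_
    norm_num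
  have hgradc : ContinuousOn (fun p : M × ℝ ↦ g.gradSq (ρ p.2) p.1) (univ ×ˢ O) :=
    (contMDiffOn_gradSq_family g hO.uniqueDiffOn hρ).continuousOn
  -- the energy `E`, its derivative `E'`, the gradient term `G` and the error term `R`
  set E : ℝ → ℝ := fun s ↦ ∫ x, (ρ s x - c₀) ^ 2 * (η x * Real.exp (-V x)) ∂μ with hE
  set E' : ℝ → ℝ := fun s ↦
    ∫ x, (2 * (ρ s x - c₀) * deriv (fun r ↦ ρ r x) s) * (η x * Real.exp (-V x)) ∂μ with hE'
  set G : ℝ → ℝ := fun s ↦ ∫ x, g.gradSq (ρ s) x * (η x * Real.exp (-V x)) ∂μ with hG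
  set R : ℝ → ℝ := fun s ↦ ∫ x, (ρ s x - c₀) ^ 2 * (Lη x * Real.exp (-V x)) ∂μ with hR
  have hEd : ∀ s ∈ O, HasDerivAt E (E' s) s := fun s hs ↦
    hasDerivAt_integral_mul_of_hasCompactSupport μ hwE hwEc hO hF hF' hd hs
  have hE'c : ContinuousOn E' O := continuousOn_integral_mul_of_hasCompactSupport μ hwE hwEc hF'
  have hGc : ContinuousOn G O := continuousOn_integral_mul_of_hasCompactSupport μ hwE hwEc hgradc
  have hRc : ContinuousOn R O := continuousOn_integral_mul_of_hasCompactSupport μ hwR hwRc hF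
  -- `E' = -2 G + R` on `[0, T]` (the equation and the energy identity with a cut-off)
  have hE'eq : ∀ s ∈ Icc 0 T, E' s = -2 * G s + R s := by
    intro s hs
    have hsO := hTO hs
    have hid := integral_sub_mul_cutoff_mul_weightedLaplacian hg (hslice s hsO) hη hηc hV c₀
    have e0 : E' s = 2 * ∫ x, (ρ s x - c₀) * η x * (g.dalembertian (ρ s) x
        - g.innerDual x (mvfderiv (𝓡 n) V x).toLinearMap (mvfderiv (𝓡 n) (ρ s) x).toLinearMap) *
          Real.exp (-V x) ∂μ := by
      rw [hE', ← integral_const_mul]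
      refine integral_congr_ae (Eventually.of_forall fun x ↦ ?_)
      simp only [heq s hs x]
      ring
    have e1 : ∫ x, η x * g.gradSq (ρ s) x * Real.exp (-V x) ∂μ = G s :=
      integral_congr_ae (Eventually.of_forall fun x ↦ by ring)
    have e2 : ∫ x, (ρ s x - c₀) ^ 2 * (g.dalembertian η x
        - g.innerDual x (mvfderiv (𝓡 n) V x).toLinearMap (mvfderiv (𝓡 n) η x).toLinearMap) *
          Real.exp (-V x) ∂μ = R s :=
      integral_congr_ae (Eventually.of_forall fun x ↦ by simp only [hLη]; ring)
    rw [e0, hid, e1, e2]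
    ring
  -- the fundamental theorem of calculus on `[0, T]`
  have huIcc : uIcc (0 : ℝ) T = Icc 0 T := uIcc_of_le h01
  have hFTC : ∫ s in (0 : ℝ)..T, E' s = E T - E 0 :=
    intervalIntegral.integral_eq_sub_of_hasDerivAt (fun s hs ↦ hEd s (hTO (huIcc ▸ hs)))
      ((hE'c.mono hTO).intervalIntegrable_of_Icc h01)
  have hGi : IntervalIntegrable G volume 0 T := (hGc.mono hTO).intervalIntegrable_of_Icc h01
  have hRi : IntervalIntegrable R volume 0 T := (hRc.mono hTO).intervalIntegrable_of_Icc h01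
  have hsplit : ∫ s in (0 : ℝ)..T, E' s =
      -2 * (∫ s in (0 : ℝ)..T, G s) + ∫ s in (0 : ℝ)..T, R s := by
    have e1 : ∫ s in (0 : ℝ)..T, E' s = ∫ s in (0 : ℝ)..T, (-2 * G s + R s) :=
      intervalIntegral.integral_congr fun s hs ↦ hE'eq s (huIcc ▸ hs)
    have e2 : ∫ s in (0 : ℝ)..T, (-2 * G s + R s) =
        (∫ s in (0 : ℝ)..T, -2 * G s) + ∫ s in (0 : ℝ)..T, R s :=
      intervalIntegral.integral_add (hGi.const_mul (-2)) hRi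
    have e3 : ∫ s in (0 : ℝ)..T, -2 * G s = -2 * ∫ s in (0 : ℝ)..T, G s :=
      intervalIntegral.integral_const_mul _ _
    rw [e1, e2, e3]
  -- Fubini on the strip for `G` and `R`
  have hGF : ∫ p, g.gradSq (ρ p.2) p.1 * (η p.1 * Real.exp (-V p.1))
      ∂(μ.prod (volume : Measure ℝ)).restrict (univ ×ˢ Ioo 0 T) = ∫ s in (0 : ℝ)..T, G s :=
    integral_strip_eq_intervalIntegral μ h01
      (integrable_strip_mul_of_hasCompactSupport μ (hgradc.mono (prod_mono le_rfl hTO)) hwE hwEc)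
  have hRF : ∫ p, (ρ p.2 p.1 - c₀) ^ 2 * (Lη p.1 * Real.exp (-V p.1))
      ∂(μ.prod (volume : Measure ℝ)).restrict (univ ×ˢ Ioo 0 T) = ∫ s in (0 : ℝ)..T, R s :=
    integral_strip_eq_intervalIntegral μ h01
      (integrable_strip_mul_of_hasCompactSupport μ (hF.mono (prod_mono le_rfl hTO)) hwR hwRc)
  have eE0 : E 0 = ∫ x, (ρ 0 x - c₀) ^ 2 * (η x * Real.exp (-V x)) ∂μ := rfl
  have eET : E T = ∫ x, (ρ T x - c₀) ^ 2 * (η x * Real.exp (-V x)) ∂μ := rfl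
  rw [hGF, hRF]
  linarith [hFTC, hsplit, eE0, eET]

/-- **The energy estimate for the weighted heat flow on a complete manifold** (registered helper
`helper_energyEstimate` of the crux `EntropyRung.NoncompactShrinkerGap`): with cut-offs
`η_k ∈ C_c^∞`, `0 ≤ η_k ≤ 1`, `η_k ↑`, eventually `1` near every point, `|Lη_k| ≤ C`, a solution
`ρ` of `∂ₛρ = Lρ` on `[0, T]` (smooth on `M × O`, `O ⊇ [0, T]` open) with `(ρ − c₀)² e^{-V}`
integrable on the strip `M × (0, T)` and at `s = 0` has `|∇ρ|² e^{-V}` integrable on the strip and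
`∫∫_{M×(0,T)} |∇ρ|² e^{-V} ≤ ½ ∫ (ρ(0) − c₀)² e^{-V}`. Proof: `two_mul_integral_gradSq_cutoff_eq`
with `η = η_k`; `E_k(T) ≥ 0`, `E_k(0) ≤ ∫ (ρ₀ − c₀)² e^{-V}`; the error term tends to `0` by
dominated convergence (`|Lη_k| ≤ C`, `Lη_k(x) = 0` for large `k`); `k → ∞` by Fatou and
dominated convergence (`η_k ↑ 1`). [cite: CarrilloNi2009, §4 (integration by parts on the complete soliton)] -/
theorem helper_energyEstimate : ∀ (n : ℕ) (M : Type*) [TopologicalSpace M] [T2Space M] [SecondCountableTopology M] [ChartedSpace (EuclideanSpace ℝ (Fin n)) M] [IsManifold (𝓡 n) ∞ M] [T3Space M] [MeasurableSpace M] [BorelSpace M] (g : PseudoRiemannianMetric (𝓡 n) ∞ (EuclideanSpace ℝ (Fin n)) (TangentSpace (𝓡 n) : M → Type _)) [g.HasLeviCivita] (V : M → ℝ), g.IsRiemannian → ContMDiff (𝓡 n) 𝓘(ℝ, ℝ) ∞ V → ∀ (η : ℕ → M → ℝ) (C : ℝ), (∀ k, ContMDiff (𝓡 n) 𝓘(ℝ,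 ℝ) ∞ (η k)) → (∀ k, HasCompactSupport (η k)) → (∀ k x, 0 ≤ η k x ∧ η k x ≤ 1) → (∀ k x, η k x ≤ η (k + 1) x) → (∀ x, ∀ᶠ k in atTop, ∀ᶠ y in 𝓝 x, η k y = 1) → (∀ k x, |g.dalembertian (η k) x - g.innerDual x (mvfderiv (𝓡 n) V x).toLinearMap (mvfderiv (𝓡 n) (η k) x).toLinearMap| ≤ C) → ∀ (T : ℝ) (O : Set ℝ) (ρ : ℝ → M → ℝ), 0 < T → IsOpen O → Icc 0 T ⊆ O → ContMDiffOn ((𝓡 n).prod 𝓘(ℝ, ℝ)) 𝓘(ℝ, ℝ) ∞ (fun p : M × ℝ ↦ ρ p.2 p.1) (univ ×ˢ O) → (∀ s ∈ Icc 0 T, ∀ x, deriv (fun r ↦ ρ r x) s = g.dalembertian (ρ s) x - g.innerDual x (mvfderiv (𝓡 n) V x).toLinearMap (mvfderiv (𝓡 n) (ρ s) x).toLinearMap) → ∀ (c₀ : ℝ), Integrable (fun p : M × ℝ ↦ (ρ p.2 p.1 - c₀) ^ 2 * Real.exp (-V p.1)) ((g.riemVolume.prod (volume : Measure ℝ)).restrict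 (univ ×ˢ Ioo 0 T)) → Integrable (fun x ↦ (ρ 0 x - c₀) ^ 2 * Real.exp (-V x)) g.riemVolume → Integrable (fun p : M × ℝ ↦ g.gradSq (ρ p.2) p.1 * Real.exp (-V p.1)) ((g.riemVolume.prod (volume : Measure ℝ)).restrict (univ ×ˢ Ioo 0 T)) ∧ ∫ p in univ ×ˢ Ioo 0 T, g.gradSq (ρ p.2) p.1 * Real.exp (-V p.1) ∂(g.riemVolume.prod (volume : Measure ℝ)) ≤ 1 / 2 * ∫ x, (ρ 0 x - c₀) ^ 2 * Real.exp (-V x) ∂g.riemVolume := by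
  intro n M _ _ _ _ _ _ _ _ g _ V hg hV η C hηs hηc hη01 _hmono hη1 hLη T O ρ hT hO hTO hρ heq c₀
    hInt h0
  haveI := CarrilloNi2009_shrinkerLSI.isFiniteMeasureOnCompacts_riemVolume hg
  haveI := sigmaFinite_riemVolume hg
  have h1 : (1 : ℕ∞ω) ≤ (∞ : ℕ∞ω) := WithTop.coe_le_coe.mpr le_top
  have h2 : (2 : ℕ∞ω) ≤ (∞ : ℕ∞ω) := WithTop.coe_le_coe.mpr le_top
  set μ : Measure M := g.riemVolume with hμ
  set ν : Measure (M × ℝ) := (μ.prod (volume : Measure ℝ)).restrict (univ ×ˢ Ioo 0 T) with hν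
  set L : ℕ → M → ℝ := fun k x ↦ g.dalembertian (η k) x
    - g.innerDual x (mvfderiv (𝓡 n) V x).toLinearMap (mvfderiv (𝓡 n) (η k) x).toLinearMap with hL
  set A : ℝ := ∫ x, (ρ 0 x - c₀) ^ 2 * Real.exp (-V x) ∂μ with hA
  set B : ℝ := ∫ p, (ρ p.2 p.1 - c₀) ^ 2 * Real.exp (-V p.1) ∂ν with hB
  set r : ℕ → ℝ := fun k ↦ ∫ p, (ρ p.2 p.1 - c₀) ^ 2 * (L k p.1 * Real.exp (-V p.1)) ∂ν with hr
  set F : M × ℝ → ℝ := fun p ↦ g.gradSq (ρ p.2) p.1 * Real.exp (-V p.1) with hFdef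
  have hec : Continuous fun x ↦ Real.exp (-V x) := Real.continuous_exp.comp hV.continuous.neg
  -- Step 1: the integrated identity for every `k`
  have hid : ∀ k, 2 * ∫ p, g.gradSq (ρ p.2) p.1 * (η k p.1 * Real.exp (-V p.1)) ∂ν =
      ∫ x, (ρ 0 x - c₀) ^ 2 * (η k x * Real.exp (-V x)) ∂μ
        - ∫ x, (ρ T x - c₀) ^ 2 * (η k x * Real.exp (-V x)) ∂μ + r k := fun k ↦
    two_mul_integral_gradSq_cutoff_eq hg hV (hηs k) (hηc k) hT hO hTO hρ heq c₀
  -- Step 2: `E_k(0) ≤ A`, `E_k(T) ≥ 0`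
  have hE0 : ∀ k, ∫ x, (ρ 0 x - c₀) ^ 2 * (η k x * Real.exp (-V x)) ∂μ ≤ A := fun k ↦ by
    refine integral_mono_of_nonneg (Eventually.of_forall fun x ↦ ?_) h0
      (Eventually.of_forall fun x ↦ ?_)
    · exact mul_nonneg (sq_nonneg _) (mul_nonneg (hη01 k x).1 (Real.exp_nonneg _))
    · exact mul_le_mul_of_nonneg_left (mul_le_of_le_one_left (Real.exp_nonneg _) (hη01 k x).2)
        (sq_nonneg _)
  have hET : ∀ k, 0 ≤ ∫ x, (ρ T x - c₀) ^ 2 * (η k x * Real.exp (-V x)) ∂μ := fun k ↦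
    integral_nonneg fun x ↦ mul_nonneg (sq_nonneg _) (mul_nonneg (hη01 k x).1 (Real.exp_nonneg _))
  -- Step 3: the error terms `r k` are dominated by `C (ρ - c₀)² e^{-V}` and tend to `0`
  have hcontρ : ContinuousOn (fun p : M × ℝ ↦ ρ p.2 p.1) (univ ×ˢ Ioo 0 T) :=
    hρ.continuousOn.mono (prod_mono le_rfl (Ioo_subset_Icc_self.trans hTO))
  have hLc : ∀ k, Continuous (L k) := fun k ↦
    (continuous_dalembertian g ((hηs k).of_le h2)).sub
      (continuous_innerDual_mvfderiv g (hV.of_le h1) ((hηs k).of_le h1))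
  have hr_meas : ∀ k, AEStronglyMeasurable
      (fun p : M × ℝ ↦ (ρ p.2 p.1 - c₀) ^ 2 * (L k p.1 * Real.exp (-V p.1))) ν := fun k ↦
    aestronglyMeasurable_strip μ (((hcontρ.sub continuousOn_const).pow 2).mul
      (((hLc k).comp continuous_fst).mul (hec.comp continuous_fst)).continuousOn)
  have hr_bound : ∀ k (p : M × ℝ), ‖(ρ p.2 p.1 - c₀) ^ 2 * (L k p.1 * Real.exp (-V p.1))‖ ≤
      C * ((ρ p.2 p.1 - c₀) ^ 2 * Real.exp (-V p.1)) := fun k p ↦ by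
    rw [Real.norm_eq_abs, abs_mul, abs_mul, abs_of_nonneg (sq_nonneg _),
      abs_of_nonneg (Real.exp_nonneg _)]
    have hC := hLη k p.1
    have h0' : 0 ≤ (ρ p.2 p.1 - c₀) ^ 2 * Real.exp (-V p.1) :=
      mul_nonneg (sq_nonneg _) (Real.exp_nonneg _)
    calc (ρ p.2 p.1 - c₀) ^ 2 * (|L k p.1| * Real.exp (-V p.1))
        = |L k p.1| * ((ρ p.2 p.1 - c₀) ^ 2 * Real.exp (-V p.1)) := by ring
      _ ≤ C * ((ρ p.2 p.1 - c₀) ^ 2 * Real.exp (-V p.1)) := mul_le_mul_of_nonneg_right hC h0'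
  have hdom : Integrable (fun p : M × ℝ ↦ C * ((ρ p.2 p.1 - c₀) ^ 2 * Real.exp (-V p.1))) ν :=
    hInt.const_mul C
  have hr_tendsto : Tendsto r atTop (𝓝 0) := by
    have hlim : ∀ p : M × ℝ, Tendsto (fun k ↦ (ρ p.2 p.1 - c₀) ^ 2 * (L k p.1 * Real.exp (-V p.1)))
        atTop (𝓝 0) := fun p ↦ by
      refine tendsto_const_nhds.congr' ?_
      filter_upwards [weightedLaplacian_cutoff_eventually_eq_zero (g := g) (V := V) hη1 p.1] with k hk
      rw [show L k p.1 = 0 from hk, zero_mul, mul_zero]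
    have h := tendsto_integral_of_dominated_convergence
      (fun p : M × ℝ ↦ C * ((ρ p.2 p.1 - c₀) ^ 2 * Real.exp (-V p.1))) hr_meas hdom
      (fun k ↦ Eventually.of_forall (hr_bound k)) (Eventually.of_forall hlim)
    simpa [hr] using h
  have hr_le : ∀ k, r k ≤ C * B := fun k ↦ by
    calc r k ≤ ‖r k‖ := Real.le_norm_self _
      _ ≤ ∫ p, ‖(ρ p.2 p.1 - c₀) ^ 2 * (L k p.1 * Real.exp (-V p.1))‖ ∂ν :=
          norm_integral_le_integral_norm _
      _ ≤ ∫ p, C * ((ρ p.2 p.1 - c₀) ^ 2 * Real.exp (-V p.1)) ∂ν :=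
          integral_mono_of_nonneg (Eventually.of_forall fun p ↦ norm_nonneg _) hdom
            (Eventually.of_forall (hr_bound k))
      _ = C * B := integral_const_mul _ _
  -- Step 4: `∫ η_k F ≤ (A + r k) / 2 ≤ (A + C B) / 2`
  have hI_le : ∀ k, ∫ p, η k p.1 * F p ∂ν ≤ (A + r k) / 2 := fun k ↦ by
    have e : ∫ p, η k p.1 * F p ∂ν = ∫ p, g.gradSq (ρ p.2) p.1 * (η k p.1 * Real.exp (-V p.1)) ∂ν :=
      integral_congr_ae (Eventually.of_forall fun p ↦ by simp only [hFdef]; ring)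
    rw [e]
    linarith [hid k, hE0 k, hET k]
  -- Step 5: Fatou gives the integrability of `F = |∇ρ|² e^{-V}` on the strip
  have hgradc : ContinuousOn (fun p : M × ℝ ↦ g.gradSq (ρ p.2) p.1) (univ ×ˢ O) :=
    (contMDiffOn_gradSq_family g hO.uniqueDiffOn hρ).continuousOn
  have hFm : AEStronglyMeasurable F ν :=
    aestronglyMeasurable_strip μ ((hgradc.mono (prod_mono le_rfl (Ioo_subset_Icc_self.trans hTO))).mul
      (hec.comp continuous_fst).continuousOn)
  have hF0 : ∀ p, 0 ≤ F p := fun p ↦ mul_nonneg (g.gradSq_nonneg hg _ _) (Real.exp_nonneg _)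
  have hχF : ∀ k, Integrable (fun p : M × ℝ ↦ η k p.1 * F p) ν := fun k ↦ by
    have hwk : Continuous fun x ↦ η k x * Real.exp (-V x) := (hηs k).continuous.mul hec
    have hwkc : HasCompactSupport fun x ↦ η k x * Real.exp (-V x) := (hηc k).mul_right
    have h := integrable_strip_mul_of_hasCompactSupport μ (hgradc.mono (prod_mono le_rfl hTO))
      hwk hwkc
    exact h.congr (Eventually.of_forall fun p ↦ by simp only [hFdef]; ring)
  have hFint : Integrable F ν :=
    CarrilloNi2009_shrinkerLSI.integrable_of_forall_integral_cutoff_mul_le hFm hF0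
      (fun k p ↦ (hη01 k p.1).1) hχF (fun p ↦ tendsto_cutoff hη1 p.1) (K := (A + C * B) / 2)
      fun k ↦ (hI_le k).trans (by linarith [hr_le k])
  -- Step 6: `∫ η_k F → ∫ F` (dominated convergence) and the bound
  have hI_tendsto : Tendsto (fun k ↦ ∫ p, η k p.1 * F p ∂ν) atTop (𝓝 (∫ p, F p ∂ν)) := by
    refine tendsto_integral_of_dominated_convergence F (fun k ↦ (hχF k).aestronglyMeasurable) hFint
      (fun k ↦ Eventually.of_forall fun p ↦ ?_) (Eventually.of_forall fun p ↦ ?_)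
    · rw [Real.norm_eq_abs, abs_of_nonneg (mul_nonneg (hη01 k p.1).1 (hF0 p))]
      exact mul_le_of_le_one_left (hF0 p) (hη01 k p.1).2
    · simpa using (tendsto_cutoff hη1 p.1).mul_const (F p)
  have hb_tendsto : Tendsto (fun k ↦ (A + r k) / 2) atTop (𝓝 ((A + 0) / 2)) :=
    (tendsto_const_nhds.add hr_tendsto).div_const 2
  have hfinal : ∫ p, F p ∂ν ≤ (A + 0) / 2 := le_of_tendsto_of_tendsto' hI_tendsto hb_tendsto hI_le
  refine ⟨hFint, ?_⟩
  have hgoal : ∫ p, F p ∂ν ≤ 1 / 2 * A := by linarith [hfinal]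
  simpa only [hFdef] using hgoal

end Energy

end Summit.SmoothPoincare4.SmoothPoincare4.Theorems.NoncompactShrinkerGapHeat

end
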